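/-
Copyright (c) 2026 the pub-hodgecm-mathlib formalisation cell (harness21).  Prover seat hodgecm-mathlib-LH4-p09 (g8), req620 Track A «(D-RAM) FOUR-FRAME» squad
(heir dealer LH4-plan (g13) WORD #74 (2): (d) lev-trunk assembly, PART 2).  2026-09-04.
-/
import Summits.HodgeConjecture.HodgeConjecture.Theorems.F0P3cDyRamLabelledKappaTwoTokenGlued            -- ★ p860000 (this seat) T2b: G1 foot ∕ tube-on-D₁-locus heads; brings K4 K5, `modelToken_data`, T1
import Summits.HodgeConjecture.HodgeConjecture.Theorems.F0P3cDyRamLabelledKappaTwoTokenGluedOffLocus   -- p860107 (this seat) T2c: generic off-locus row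
import Summits.HodgeConjecture.HodgeConjecture.Theorems.F0P3cDyRamLabelledKappaTwoTokenRotations       -- ★ p860072 (this seat) T3: two-token rotation engine
import Summits.HodgeConjecture.HodgeConjecture.Theorems.F0P3cDyRamLabelledGluedLocusCensus              -- ★ p859544 (this seat): brings ★ F1∕F2 emptiness `stratum_G1_eq_empty_of_odd`, `glued_eq_empty_of_{offFoot,depth_lt}`
import HarnessLib

/-!
# (D-RAM) four-frame, STAGE 1b — (d) LEV-TRUNK ASSEMBLY, PART 2: the GLUED cells `G1(ρ,s)` and `G2(ρ,s)` of the two-token labelled κ-table at the letters of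
# record, IN THE CURRENCY OF F0P3a-p01 (g36)'s `LevLabelledBoxSum (ℓ₁ ℓ₂)` (★ p860066: binders `hG1 ∕ hG2` token for token)

Helper brick for dealer LH4-plan (g13) WORD #74 (2) ((d) `LevTrunksOfBoxSum`, this seat, second hand to F0P3a-p01 (g36)): `Theorems/` only, statement-first, ★-only imports,
lane `--supports stmt-HodgeConjecture-24833 --as helper`; PAYS NO tier-0 row (count-neutral).  Under the box-sum fence `2 ≤ d`, `2d ≤ nᵢ + 1`, `ℓ₁ ≤ 2`, `ℓ₂ ≤ nᵢ`:
* §1 G1-emptiness for any summand (`…_of_odd' ∕ _of_offFoot' ∕ _of_depth_lt'`, ★ F1∕F2) and the tube-on-the-`D₂`-locus head under the VACUITY hypothesis `ℓ₂ + 2ρ ≤ 2n₂`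
  (`finsum_kappaCount_mul_stabiliserWeight_stratum_G1_sep_levels_tube_locusTwo_of_vac`, replacing T2b's guard `ℓ₂ ≤ 2ρ`).
* §2 **`cell_G1`** = `hG1` of `LevLabelledBoxSum` with `ω := ω(−1)`, `εG 0 := (ω·ω(1+f₀), ω·ω(f₀)ω(1+f₀), ω(f₀))` — by cases: odd `s` (empty); `n₁ = n₂ + s` (`D₁` on its
  locus: tube ★ T2b `…_tube_locusOne`, foot ★ T2b `…_levels_foot`, shallow empty); `2n₁ = 2n₂ + s` (§1, or empty off the tube); generic (T2c `…_levels_offLocus`).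
* §3 **`cell_G2`** = `hG2` with `εG 1 := (ω·ω(f₁)ω(1+f₁), ω·ω(1+f₁), ω(f₁))` — §2 on the swapped datum `(β, α; n₂, n₁, n₃)` through ★ T3 `…_G2_sep_two_of_G1`
  (the swapped letters of record are the swapped datum's letters of record on the nose).

HONEST LABEL: helper assembly for HYPOTHESES (the four lev trunk letters `hTrunkLo∕Hi∕CLo∕CHi` of ★ p859769 ∕ ★ p859848); STAGE-1b tier-0 rows and the ED. 5∕6 law stubs
stay OPEN; HC_CM is proved only modulo the 7 printed citations (2 remaining named inputs: hLiu418 = `stmt-HodgeConjecture-24832`, h413 = `stmt-HodgeConjecture-24833`) until rung 0 closes.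

## References
* [Kottwitz1986BaseChangeUnits] R. E. Kottwitz, *Base change for unit elements of Hecke algebras*, Compositio Math. 60 (1986), §1 pp. 240–241 (κ-orbital integrals of units as signed lattice counts).
* [LanglandsShelstad1987] R. P. Langlands, D. Shelstad, *On the definition of transfer factors*, Math. Ann. 278 (1987), §3 (κ as a character).
* [Rogawski1990] J. D. Rogawski, *Automorphic Representations of Unitary Groups in Three Variables*, Ann. of Math. Stud. 123 (1990), §4.9 Prop. 4.9.1 (a)(b) p. 55.
* [Serre1979] J.-P. Serre, *Local Fields*, GTM 67 (1979), Ch. V §3 Prop. 5, Cor. 3 (norm residue symbol; glue-unit rationality depth).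
-/

set_option autoImplicit false

noncomputable section

namespace Summit.HodgeConjecture.HodgeConjecture.Cruxes.H413.F0P3cDyRamLevLabelledCellsGlued

open Matrix WithZero
open Literature.NumberTheory.Automorphic Literature.NumberTheory.Automorphic.HermitianLattice Literature.NumberTheory.Automorphic.UnitaryGroup
open Literature.NumberTheory.Automorphic.UnitaryLatticeTree Literature.NumberTheory.Automorphic.UnitaryThreeFourFrame
open Literature.NumberTheory.LocalFields.WildQuadraticDatum
open Summit.HodgeConjecture.HodgeConjecture.Cruxes.H413.F0P3cDyRamDiagonalTorusDefs
open Summit.HodgeConjecture.HodgeConjecture.Cruxes.H413.F0P3cDyRamDiagonalStrataDefs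
open Summit.HodgeConjecture.HodgeConjecture.Cruxes.H413.F0P3cDyRamDiagonalKappaCountDefs
open Summit.HodgeConjecture.HodgeConjecture.Cruxes.H413.F0P3cDyRamDiagonalGluedStabiliserIndex (ne_zero_and_v_lt_one_of_v_eq_exp)
open Summit.HodgeConjecture.HodgeConjecture.Cruxes.H413.F0P3cDyRamDiagonalGluedStratum (stratum_G1_eq stratum_G1_eq_empty_of_odd)
open Summit.HodgeConjecture.HodgeConjecture.Cruxes.H413.F0P3cDyRamDiagonalGluedTubeContribution (glued_eq_empty_of_offFoot glued_eq_empty_of_depth_lt)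
open Summit.HodgeConjecture.HodgeConjecture.Cruxes.H413.F0P3cDyRamElementDatumParity (isoceles_of_isElementDatum)
open Summit.HodgeConjecture.HodgeConjecture.Cruxes.H413.F0P3cDyRamFourFrameCensusDefs
open Summit.HodgeConjecture.HodgeConjecture.Cruxes.H413.F0P3cDyRamLabelledGluedLocusCensusFoot (modelToken_data)
open Summit.HodgeConjecture.HodgeConjecture.Cruxes.H413.F0P3cDyRamLabelledKappaGluedLocus (finsum_kappaCount_mul_stabiliserWeight_stratum_G1_sep_eq_of_vacuous)
open Summit.HodgeConjecture.HodgeConjecture.Cruxes.H413.F0P3cDyRamLabelledKappaSqTokenCells (sqToken_differences)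
open Summit.HodgeConjecture.HodgeConjecture.Cruxes.H413.F0P3cDyRamLabelledTwoTokenReductions
open Summit.HodgeConjecture.HodgeConjecture.Cruxes.H413.F0P3cDyRamLabelledKappaTwoTokenGlued
open Summit.HodgeConjecture.HodgeConjecture.Cruxes.H413.F0P3cDyRamLabelledKappaTwoTokenGluedOffLocus
open Summit.HodgeConjecture.HodgeConjecture.Cruxes.H413.F0P3cDyRamLabelledKappaTwoTokenRotations
open scoped Valued WithZero Matrix MatrixGroups

variable {K : Type} [Field K] [Valued K ℤᵐ⁰] [CompleteSpace K] [Fintype 𝓀[K]] {σ : K →+* K} {ϖ : K} {d t : ℕ} {α β : K} {N₀ n₁ n₂ n₃ : ℕ}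
  {T : GL (Fin 3) K}

/-! ## §1  G1: emptiness for any summand; the `D₂`-locus tube under the vacuity hypothesis -/

omit [CompleteSpace K] [Fintype 𝓀[K]] in
/-- Odd `s` ⇒ `G1(ρ,s)` is empty (★ F1), any summand. [cite: Kottwitz1986BaseChangeUnits, §1 pp. 240–241] -/
theorem finsum_stratum_G1_sep_eq_zero_of_odd' (hD : IsRamifiedQuadraticDatum σ ϖ d t) (T : GL (Fin 3) K) (ρ s : ℕ) (hρ : 1 ≤ ρ) (hodd : ¬ 2 ∣ s)
    (L : Submodule 𝒪[K] (Fin 3 → K) → Prop) (w : Submodule 𝒪[K] (Fin 3 → K) → ℚ) :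
    ∑ᶠ M ∈ {M | M ∈ stratum σ ϖ T ![2 * ρ, 2 * ρ + s, 2 * ρ + s] ∧ L M}, w M = 0 := by
  obtain ⟨-, hvσ, hϖ, hfix, -, -, -⟩ := hD
  have hset : {M | M ∈ stratum σ ϖ T ![2 * ρ, 2 * ρ + s, 2 * ρ + s] ∧ L M} = ∅ :=
    Set.eq_empty_of_forall_notMem fun M ⟨hM, _⟩ => by
      rw [stratum_G1_eq_empty_of_odd hvσ hfix hϖ T hρ hodd] at hM
      exact hM
  rw [hset, finsum_mem_empty]

omit [CompleteSpace K] [Fintype 𝓀[K]] in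
/-- Off the foot and below the tube ⇒ `G1(ρ, 2t′)` is empty (★ F2), any summand. [cite: Kottwitz1986BaseChangeUnits, §1 pp. 240–241] -/
theorem finsum_stratum_G1_sep_eq_zero_of_offFoot' (hD : IsRamifiedQuadraticDatum σ ϖ d t) (hE : IsElementDatum σ ϖ N₀ α β n₁ n₂ n₃)
    (hT : (T : Matrix (Fin 3) (Fin 3) K) = Matrix.diagonal ![α, β, 1]) (ρ t' : ℕ) (hρ : 1 ≤ ρ) (ht' : 1 ≤ t')
    (hne : n₁ ≠ n₂ + 2 * t') (hlow : ¬ (2 * ρ + 2 * t' ≤ n₁ ∧ 2 * ρ ≤ n₂)) (L : Submodule 𝒪[K] (Fin 3 → K) → Prop) (w : Submodule 𝒪[K] (Fin 3 → K) → ℚ) :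
    ∑ᶠ M ∈ {M | M ∈ stratum σ ϖ T ![2 * ρ, 2 * ρ + 2 * t', 2 * ρ + 2 * t'] ∧ L M}, w M = 0 := by
  obtain ⟨-, hvσ, hϖ, hfix, -, -, -⟩ := hD
  obtain ⟨hαn, hβn, -, -, -, h₁, h₂, -, -, -, -⟩ := hE
  obtain ⟨hϖ0, hϖ1⟩ := ne_zero_and_v_lt_one_of_v_eq_exp hϖ
  have hset : {M | M ∈ stratum σ ϖ T ![2 * ρ, 2 * ρ + 2 * t', 2 * ρ + 2 * t'] ∧ L M} = ∅ :=
    Set.eq_empty_of_forall_notMem fun M ⟨hM, _⟩ => by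
      rw [stratum_G1_eq hvσ hfix hϖ T hρ (by omega : 1 ≤ 2 * t'), glued_eq_empty_of_offFoot σ hϖ0 hϖ1
        (UnitaryThreeFourFrame.v_eq_one_of_mul_map_eq_one hvσ hαn) (UnitaryThreeFourFrame.v_eq_one_of_mul_map_eq_one hvσ hβn)
        T hT h₁ h₂ ρ (2 * t') hne hlow] at hM
      exact hM
  rw [hset, finsum_mem_empty]

omit [CompleteSpace K] [Fintype 𝓀[K]] in
/-- `n₃ < ρ` ⇒ `G1(ρ,s)` is empty (★ F2), any summand. [cite: Kottwitz1986BaseChangeUnits, §1 pp. 240–241] -/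
theorem finsum_stratum_G1_sep_eq_zero_of_depth_lt' (hD : IsRamifiedQuadraticDatum σ ϖ d t) (hE : IsElementDatum σ ϖ N₀ α β n₁ n₂ n₃)
    (hT : (T : Matrix (Fin 3) (Fin 3) K) = Matrix.diagonal ![α, β, 1]) (ρ s : ℕ) (hρ : 1 ≤ ρ) (hs : 1 ≤ s) (hlt : n₃ < ρ)
    (L : Submodule 𝒪[K] (Fin 3 → K) → Prop) (w : Submodule 𝒪[K] (Fin 3 → K) → ℚ) :
    ∑ᶠ M ∈ {M | M ∈ stratum σ ϖ T ![2 * ρ, 2 * ρ + s, 2 * ρ + s] ∧ L M}, w M = 0 := by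
  obtain ⟨-, hvσ, hϖ, hfix, -, -, -⟩ := hD
  obtain ⟨hαn, hβn, -, -, -, -, -, h₃, -, -, -⟩ := hE
  have h₃' : Valued.v (β - α) = Valued.v ϖ ^ n₃ := by rw [Valuation.map_sub_swap, h₃]
  have hset : {M | M ∈ stratum σ ϖ T ![2 * ρ, 2 * ρ + s, 2 * ρ + s] ∧ L M} = ∅ :=
    Set.eq_empty_of_forall_notMem fun M ⟨hM, _⟩ => by
      rw [stratum_G1_eq hvσ hfix hϖ T hρ hs, glued_eq_empty_of_depth_lt σ hϖ
        (UnitaryThreeFourFrame.v_eq_one_of_mul_map_eq_one hvσ hαn) (UnitaryThreeFourFrame.v_eq_one_of_mul_map_eq_one hvσ hβn)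
        T hT h₃' ρ s hlt] at hM
      exact hM
  rw [hset, finsum_mem_empty]

open Classical in
/-- **TWO-TOKEN κ-G1 CELL ON THE `D₂` LOCUS `n₁ = n₂ + t′`, UNDER THE VACUITY HYPOTHESIS `ℓ₂ + 2ρ ≤ 2n₂`** (any regime — ★ κG1's value is `0` off the tube there):
`D₁` is off its locus (read `ℓ₁ + 2ρ + t′ ≤ n₂`, ★ T2b `modelToken_read_G1_iff`), `D₂` is vacuous on its locus (★ K4 `…_G1_sep_eq_of_vacuous`), so the cell is
`[ℓ₁ + 2ρ + t′ ≤ n₂] · ★ κG1`.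
[cite: Kottwitz1986BaseChangeUnits, §1 pp. 240–241] [cite: LanglandsShelstad1987, §3] [cite: Rogawski1990, §4.9 Prop. 4.9.1 (a)(b) p. 55] -/
theorem finsum_kappaCount_mul_stabiliserWeight_stratum_G1_sep_levels_tube_locusTwo_of_vac (hD : IsRamifiedQuadraticDatum σ ϖ d t) (h2 : Valued.v (2 : K) < 1)
    (hE : IsElementDatum σ ϖ N₀ α β n₁ n₂ n₃) (hN₀ : d ≤ N₀) (hT : (T : Matrix (Fin 3) (Fin 3) K) = Matrix.diagonal ![α, β, 1])
    (ρ t' : ℕ) (hρ : 1 ≤ ρ) (ht' : 1 ≤ t') (hloc : n₁ = n₂ + t') (i : Fin 3) (ℓ₁ ℓ₂ : ℕ)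
    (hvac₂ : ℓ₂ + 2 * ρ ≤ 2 * n₂) (f₀ : K) (hσf₀ : σ f₀ = f₀)
    (hglue : 2 ∣ 2 * t' → n₂ = n₃ → n₁ = n₂ + 2 * t' → n₂ < 2 * ρ → 2 * ρ - n₂ ≤ n₂ - d + 1 →
      Valued.v (f₀ + (β - 1) / (α - 1)) ≤ Valued.v ϖ ^ (2 * ρ + 2 * t' - n₂)) :
    ∑ᶠ M ∈ {M | M ∈ stratum σ ϖ T ![2 * ρ, 2 * ρ + 2 * t', 2 * ρ + 2 * t'] ∧
        (LatticeInLevel ϖ ℓ₁ (Matrix.diagonal ![α - 1, β - 1, 0]) M ∧ LatticeInLevel ϖ ℓ₂ (Matrix.diagonal ![(α - 1) * (α - 1), (β - 1) * (β - 1), 0]) M)},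
        (kappaCount σ ϖ 0 i M : ℚ) * stabiliserWeight σ M =
      if ℓ₁ + 2 * ρ + t' ≤ n₂ then
        ((if 2 ∣ 2 * t' ∧ 2 * ρ ≤ min n₂ n₃ ∧ 2 * ρ + 2 * t' ≤ n₁ then
            (![(normSign σ (-1 : K) : ℚ) * (Fintype.card 𝓀[K] : ℚ) ^ (2 * ρ + 2 * t' / 2 - 1) *
                ((if 2 * d ≤ 2 * t' then (Fintype.card 𝓀[K] : ℚ) - 1 else 0) - (if 2 * t' + 2 = 2 * d then 1 else 0)), 0, 0] : Fin 3 → ℚ) i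
          else 0) +
        (if 2 ∣ 2 * t' ∧ n₂ = n₃ ∧ n₁ = n₂ + 2 * t' ∧ n₂ < 2 * ρ ∧ 2 * ρ - n₂ ≤ n₂ - d + 1 then
            (![if 2 * d ≤ 2 * t' + 2 * ((2 * ρ - n₂ + 1) / 2) then (normSign σ (-1 : K) : ℚ) * normSign σ (1 + f₀) else 0,
               if d ≤ (2 * ρ - n₂ + 1) / 2 then (normSign σ (-1 : K) : ℚ) * normSign σ f₀ * normSign σ (1 + f₀) else 0,
               if d ≤ (2 * ρ - n₂ + 1) / 2 then (normSign σ f₀ : ℚ) else 0] : Fin 3 → ℚ) i *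
              (Fintype.card 𝓀[K] : ℚ) ^ (2 * ρ + 2 * t' / 2 - (2 * ρ - n₂ + 1) / 2)
          else 0))
      else 0 := by
  classical
  have hϖ : Valued.v ϖ = exp (-1 : ℤ) := hD.2.2.1
  obtain ⟨-, -, -, -, -, h₁, h₂, h₃, -, -, -⟩ := id hE
  have hple : ∀ m n : ℕ, Valued.v ϖ ^ m ≤ Valued.v ϖ ^ n ↔ n ≤ m := fun m n => UnitaryLatticeTree.v_pow_le_v_pow_iff hϖ m n
  have hn₃ : n₃ = n₂ := by
    rcases isoceles_of_isElementDatum hD hE with ⟨h, h'⟩ | ⟨h, h'⟩ | ⟨h, h'⟩ <;> omega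
  obtain ⟨hne₁, hread₁⟩ := modelToken_read_G1_iff hϖ h₁ h₂ h₃ hloc hn₃ ht' ℓ₁ ρ
  obtain ⟨hk₂, hloc₂⟩ := sqToken_differences h₁ h₂
  rw [show 2 * n₁ = 2 * n₂ + 2 * t' by omega] at hloc₂
  have hread0 : (![(α - 1) * (α - 1), (β - 1) * (β - 1), 0] : Fin 3 → K) 0 = (α - 1) * (α - 1) := rfl
  have hread1 : (![(α - 1) * (α - 1), (β - 1) * (β - 1), 0] : Fin 3 → K) 1 = (β - 1) * (β - 1) := rfl
  have hread2 : (![(α - 1) * (α - 1), (β - 1) * (β - 1), 0] : Fin 3 → K) 2 = 0 := rfl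
  have hout₂ : (Valued.v ((![(α - 1) * (α - 1), (β - 1) * (β - 1), 0] : Fin 3 → K) 0) ≤ Valued.v ϖ ^ ℓ₂ ∧
      Valued.v ((![(α - 1) * (α - 1), (β - 1) * (β - 1), 0] : Fin 3 → K) 1) ≤ Valued.v ϖ ^ ℓ₂ ∧
      Valued.v ((![(α - 1) * (α - 1), (β - 1) * (β - 1), 0] : Fin 3 → K) 2) ≤ Valued.v ϖ ^ ℓ₂) ∧ ℓ₂ + ρ ≤ 2 * n₂ := by
    refine ⟨⟨?_, ?_, ?_⟩, by omega⟩
    · rw [hread0, map_mul, h₂, ← pow_add]; exact (hple _ _).2 (by omega)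
    · rw [hread1, map_mul, h₁, ← pow_add]; exact (hple _ _).2 (by omega)
    · rw [hread2, map_zero]; exact zero_le
  rw [finsum_stratum_G1_sep_and_eq_of_ne_left hD T ρ (2 * t') hρ (by omega) ℓ₁ _ hne₁ ℓ₂ _, if_congr hread₁ rfl rfl]
  by_cases hr₁ : ℓ₁ + 2 * ρ + t' ≤ n₂
  · rw [if_pos hr₁, if_pos hr₁]
    exact finsum_kappaCount_mul_stabiliserWeight_stratum_G1_sep_eq_of_vacuous hD h2 hE hN₀ hT ρ t' hρ ht' i f₀ hσf₀ hglue ℓ₂ (2 * n₂) _ hk₂ hloc₂ hout₂ hvac₂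
  · rw [if_neg hr₁, if_neg hr₁]

/-! ## §2  The G1 cell in box-sum currency -/

open Classical in
/-- **GLUED CELL `G1(ρ,s)` IN BOX-SUM CURRENCY** (fence `2 ≤ d`, `2d ≤ nᵢ + 1`, `ℓ₁ ≤ 2`, `ℓ₂ ≤ nᵢ`; `ω = ω(−1)`, `εG 0 = (ω·ω(1+f₀), ω·ω(f₀)ω(1+f₀), ω(f₀))`,
`E′ = ℓ₁ + 2ρ − n₂`, `f₀` the trunk's deepest glue witness): `Σᶠ_{G1(ρ,s), L₁ ∧ L₂} κᵢ·w =`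
`[2∣s ∧ 2ρ ≤ min(n₂,n₃) ∧ 2ρ+s ≤ n₁ ∧ 2ρ+ℓ₁ ≤ n₂ ∧ 2ρ+s+ℓ₁ ≤ n₁ ∧ 2ρ+ℓ₂ ≤ 2n₂]·(★ tube vector)ᵢ`
`+ [2∣s ∧ n₂ = n₃ ∧ n₁ = n₂+s ∧ n₂ < 2ρ+ℓ₁ ∧ ℓ₁+ρ ≤ n₂ ∧ E′ ≤ n₂−d+1 ∧ 2ρ+ℓ₂ ≤ 2n₂]·(εG00·[2d ≤ s+E′+1], εG01·[2d ≤ E′+1], εG02·[2d ≤ E′+1])ᵢ·q^{2ρ+s∕2−⌈E′∕2⌉}`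
— `hG1` of `LevLabelledBoxSum` token for token. [cite: Kottwitz1986BaseChangeUnits, §1 pp. 240–241] [cite: LanglandsShelstad1987, §3] [cite: Serre1979, Ch. V §3 Prop. 5, Cor. 3]
[cite: Rogawski1990, §4.9 Prop. 4.9.1 (a)(b) p. 55] -/
theorem cell_G1 (hD : IsRamifiedQuadraticDatum σ ϖ d t) (h2 : Valued.v (2 : K) < 1) (hE : IsElementDatum σ ϖ N₀ α β n₁ n₂ n₃) (hN₀ : d ≤ N₀)
    (hT : (T : Matrix (Fin 3) (Fin 3) K) = Matrix.diagonal ![α, β, 1]) (hd2 : 2 ≤ d) (hfence : 2 * d ≤ n₁ + 1 ∧ 2 * d ≤ n₂ + 1 ∧ 2 * d ≤ n₃ + 1)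
    {ℓ₁ ℓ₂ : ℕ} (hℓ₁ : ℓ₁ ≤ 2) (hℓ₂ : ℓ₂ ≤ n₁ ∧ ℓ₂ ≤ n₂ ∧ ℓ₂ ≤ n₃) (ρ s : ℕ) (hρ : 1 ≤ ρ) (hs : 1 ≤ s) (i : Fin 3) (f₀ : K) (hσf₀ : σ f₀ = f₀)
    (hf₀ : n₂ = n₃ → n₂ ≤ n₁ → Valued.v (f₀ + (β - 1) / (α - 1)) ≤ Valued.v ϖ ^ (n₁ - d + 1)) :
    ∑ᶠ M ∈ {M | M ∈ stratum σ ϖ T ![2 * ρ, 2 * ρ + s, 2 * ρ + s] ∧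
        (LatticeInLevel ϖ ℓ₁ (Matrix.diagonal ![α - 1, β - 1, 0]) M ∧ LatticeInLevel ϖ ℓ₂ (Matrix.diagonal ![(α - 1) * (α - 1), (β - 1) * (β - 1), 0]) M)},
        (kappaCount σ ϖ 0 i M : ℚ) * stabiliserWeight σ M =
      (if 2 ∣ s ∧ 2 * ρ ≤ min n₂ n₃ ∧ 2 * ρ + s ≤ n₁ ∧ 2 * ρ + ℓ₁ ≤ n₂ ∧ 2 * ρ + s + ℓ₁ ≤ n₁ ∧ 2 * ρ + ℓ₂ ≤ 2 * n₂ then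
          (![(normSign σ (-1 : K) : ℚ) * (Fintype.card 𝓀[K] : ℚ) ^ (2 * ρ + s / 2 - 1) *
              ((if 2 * d ≤ s then (Fintype.card 𝓀[K] : ℚ) - 1 else 0) - (if s + 2 = 2 * d then 1 else 0)), 0, 0] : Fin 3 → ℚ) i
        else 0) +
      (if 2 ∣ s ∧ n₂ = n₃ ∧ n₁ = n₂ + s ∧ n₂ < 2 * ρ + ℓ₁ ∧ ℓ₁ + ρ ≤ n₂ ∧ ℓ₁ + 2 * ρ - n₂ ≤ n₂ - d + 1 ∧ 2 * ρ + ℓ₂ ≤ 2 * n₂ then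
          (![if 2 * d ≤ s + (ℓ₁ + 2 * ρ - n₂ + 1) then (normSign σ (-1 : K) : ℚ) * normSign σ (1 + f₀) else 0,
             if 2 * d ≤ ℓ₁ + 2 * ρ - n₂ + 1 then (normSign σ (-1 : K) : ℚ) * normSign σ f₀ * normSign σ (1 + f₀) else 0,
             if 2 * d ≤ ℓ₁ + 2 * ρ - n₂ + 1 then (normSign σ f₀ : ℚ) else 0] : Fin 3 → ℚ) i *
            (Fintype.card 𝓀[K] : ℚ) ^ (2 * ρ + s / 2 - (ℓ₁ + 2 * ρ - n₂ + 1) / 2)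
        else 0) := by
  classical
  obtain ⟨hσ, hvσ, hϖ, hfix, hd, hd1, -⟩ := id hD
  obtain ⟨-, -, -, -, -, h₁, h₂, h₃, -, -, -⟩ := id hE
  obtain ⟨hϖ0, hϖ1⟩ := ne_zero_and_v_lt_one_of_v_eq_exp hϖ
  by_cases hs2 : 2 ∣ s
  swap
  · rw [finsum_stratum_G1_sep_eq_zero_of_odd' hD T ρ s hρ hs2, if_neg (fun h => hs2 h.1), if_neg (fun h => hs2 h.1), add_zero]
  obtain ⟨t', rfl⟩ := hs2
  have ht' : 1 ≤ t' := by omega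
  have hdvd : (2 ∣ 2 * t') := ⟨t', rfl⟩
  -- the ★ κG1 glue binder from the trunk's deepest witness
  have hglue : 2 ∣ 2 * t' → n₂ = n₃ → n₁ = n₂ + 2 * t' → n₂ < 2 * ρ → 2 * ρ - n₂ ≤ n₂ - d + 1 →
      Valued.v (f₀ + (β - 1) / (α - 1)) ≤ Valued.v ϖ ^ (2 * ρ + 2 * t' - n₂) :=
    fun _ h23 h1 _ hb => (hf₀ h23 (by omega)).trans (pow_le_pow_right_of_le_one' hϖ1.le (by omega))
  -- the foot ∕ cut-tube matching, used twice
  have hcut : ∀ (hloc₁ : n₁ = n₂ + 2 * t') (h23 : n₂ = n₃) (hgen : ¬ ℓ₁ + 2 * ρ ≤ n₂),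
      (if ℓ₂ + 2 * ρ ≤ 2 * n₂ then
          (if ℓ₁ + ρ ≤ n₂ ∧ ℓ₁ + 2 * ρ - n₂ ≤ n₂ - d + 1 then
              (![if 2 * d ≤ ℓ₁ + 2 * ρ + 2 * t' - n₂ + 1 then (normSign σ (-1 : K) : ℚ) * normSign σ (1 + f₀) else 0,
                 if 2 * d + 2 * t' ≤ ℓ₁ + 2 * ρ + 2 * t' - n₂ + 1 then (normSign σ (-1 : K) : ℚ) * normSign σ f₀ * normSign σ (1 + f₀) else 0,
                 if 2 * d + 2 * t' ≤ ℓ₁ + 2 * ρ + 2 * t' - n₂ + 1 then (normSign σ f₀ : ℚ) else 0] : Fin 3 → ℚ) i *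
                (Fintype.card 𝓀[K] : ℚ) ^ (2 * ρ + 2 * t' - (ℓ₁ + 2 * ρ + 2 * t' - n₂ + 1) / 2)
            else 0)
        else 0) =
      (if 2 ∣ 2 * t' ∧ 2 * ρ ≤ min n₂ n₃ ∧ 2 * ρ + 2 * t' ≤ n₁ ∧ 2 * ρ + ℓ₁ ≤ n₂ ∧ 2 * ρ + 2 * t' + ℓ₁ ≤ n₁ ∧ 2 * ρ + ℓ₂ ≤ 2 * n₂ then
          (![(normSign σ (-1 : K) : ℚ) * (Fintype.card 𝓀[K] : ℚ) ^ (2 * ρ + 2 * t' / 2 - 1) *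
              ((if 2 * d ≤ 2 * t' then (Fintype.card 𝓀[K] : ℚ) - 1 else 0) - (if 2 * t' + 2 = 2 * d then 1 else 0)), 0, 0] : Fin 3 → ℚ) i
        else 0) +
      (if 2 ∣ 2 * t' ∧ n₂ = n₃ ∧ n₁ = n₂ + 2 * t' ∧ n₂ < 2 * ρ + ℓ₁ ∧ ℓ₁ + ρ ≤ n₂ ∧ ℓ₁ + 2 * ρ - n₂ ≤ n₂ - d + 1 ∧ 2 * ρ + ℓ₂ ≤ 2 * n₂ then
          (![if 2 * d ≤ 2 * t' + (ℓ₁ + 2 * ρ - n₂ + 1) then (normSign σ (-1 : K) : ℚ) * normSign σ (1 + f₀) else 0,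
             if 2 * d ≤ ℓ₁ + 2 * ρ - n₂ + 1 then (normSign σ (-1 : K) : ℚ) * normSign σ f₀ * normSign σ (1 + f₀) else 0,
             if 2 * d ≤ ℓ₁ + 2 * ρ - n₂ + 1 then (normSign σ f₀ : ℚ) else 0] : Fin 3 → ℚ) i *
            (Fintype.card 𝓀[K] : ℚ) ^ (2 * ρ + 2 * t' / 2 - (ℓ₁ + 2 * ρ - n₂ + 1) / 2)
        else 0) := by
    intro hloc₁ h23 hgen
    have hA : ¬ (2 ∣ 2 * t' ∧ 2 * ρ ≤ min n₂ n₃ ∧ 2 * ρ + 2 * t' ≤ n₁ ∧ 2 * ρ + ℓ₁ ≤ n₂ ∧ 2 * ρ + 2 * t' + ℓ₁ ≤ n₁ ∧ 2 * ρ + ℓ₂ ≤ 2 * n₂) :=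
      fun h => hgen (by have := h.2.2.2.1; omega)
    rw [if_neg hA, zero_add]
    have e1 : (2 * d ≤ ℓ₁ + 2 * ρ + 2 * t' - n₂ + 1) ↔ (2 * d ≤ 2 * t' + (ℓ₁ + 2 * ρ - n₂ + 1)) := by omega
    have e2 : (2 * d + 2 * t' ≤ ℓ₁ + 2 * ρ + 2 * t' - n₂ + 1) ↔ (2 * d ≤ ℓ₁ + 2 * ρ - n₂ + 1) := by omega
    have e3 : 2 * ρ + 2 * t' - (ℓ₁ + 2 * ρ + 2 * t' - n₂ + 1) / 2 = 2 * ρ + 2 * t' / 2 - (ℓ₁ + 2 * ρ - n₂ + 1) / 2 := by omega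
    simp only [e1, e2, e3]
    by_cases hℓ₂c : ℓ₂ + 2 * ρ ≤ 2 * n₂
    · rw [if_pos hℓ₂c]
      by_cases hin : ℓ₁ + ρ ≤ n₂ ∧ ℓ₁ + 2 * ρ - n₂ ≤ n₂ - d + 1
      · rw [if_pos hin, if_pos (show 2 ∣ 2 * t' ∧ n₂ = n₃ ∧ n₁ = n₂ + 2 * t' ∧ n₂ < 2 * ρ + ℓ₁ ∧ ℓ₁ + ρ ≤ n₂ ∧ ℓ₁ + 2 * ρ - n₂ ≤ n₂ - d + 1 ∧
            2 * ρ + ℓ₂ ≤ 2 * n₂ from ⟨hdvd, h23, hloc₁, by omega, hin.1, hin.2, by omega⟩)]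
      · rw [if_neg hin, if_neg (fun h => hin ⟨h.2.2.2.2.1, h.2.2.2.2.2.1⟩)]
    · rw [if_neg hℓ₂c, if_neg (fun h => hℓ₂c (by have := h.2.2.2.2.2.2; omega))]
  by_cases hloc₁ : n₁ = n₂ + 2 * t'
  · -- `D₁` on its locus
    have h23 : n₂ = n₃ := by
      rcases isoceles_of_isElementDatum hD hE with ⟨h, h'⟩ | ⟨h, h'⟩ | ⟨h, h'⟩ <;> omega
    by_cases htube : 2 * ρ ≤ n₂
    · rw [finsum_kappaCount_mul_stabiliserWeight_stratum_G1_sep_levels_tube_locusOne hD h2 hE hN₀ hT ρ t' hρ ht' hloc₁ htube i ℓ₁ ℓ₂ f₀ hσf₀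
          (fun _ hb => (hf₀ h23 (by omega)).trans (pow_le_pow_right_of_le_one' hϖ1.le (by omega)))]
      by_cases hvac₁ : ℓ₁ + 2 * ρ ≤ n₂
      · -- vacuous `D₁`: ★ κG1's tube summand behind the `D₂` read
        rw [if_pos hvac₁]
        have hB0 : ¬ (2 ∣ 2 * t' ∧ n₂ = n₃ ∧ n₁ = n₂ + 2 * t' ∧ n₂ < 2 * ρ ∧ 2 * ρ - n₂ ≤ n₂ - d + 1) := fun h => absurd h.2.2.2.1 (by omega)
        have hB : ¬ (2 ∣ 2 * t' ∧ n₂ = n₃ ∧ n₁ = n₂ + 2 * t' ∧ n₂ < 2 * ρ + ℓ₁ ∧ ℓ₁ + ρ ≤ n₂ ∧ ℓ₁ + 2 * ρ - n₂ ≤ n₂ - d + 1 ∧ 2 * ρ + ℓ₂ ≤ 2 * n₂) :=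
          fun h => absurd h.2.2.2.1 (by omega)
        rw [if_neg hB0, if_neg hB, add_zero, add_zero]
        by_cases hℓ₂c : ℓ₂ + 2 * ρ ≤ 2 * n₂
        · rw [if_pos hℓ₂c]
          exact if_congr ⟨fun h => ⟨h.1, h.2.1, h.2.2, by omega, by omega, by omega⟩, fun h => ⟨h.1, h.2.1, h.2.2.1⟩⟩ rfl rfl
        · rw [if_neg hℓ₂c, if_neg (fun h => hℓ₂c (by have := h.2.2.2.2.2; omega))]
      · rw [if_neg hvac₁]
        exact hcut hloc₁ h23 hvac₁
    · by_cases hρm : ρ ≤ n₂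
      · -- glue foot
        rw [finsum_kappaCount_mul_stabiliserWeight_stratum_G1_sep_levels_foot hD h2 hE hN₀ hT ρ t' hρ ht' hloc₁ hρm (by omega) i ℓ₁ ℓ₂ f₀ hσf₀
            (fun hb => (hf₀ h23 (by omega)).trans (pow_le_pow_right_of_le_one' hϖ1.le (by omega)))]
        exact hcut hloc₁ h23 (by omega)
      · -- too shallow: empty
        rw [finsum_stratum_G1_sep_eq_zero_of_depth_lt' hD hE hT ρ (2 * t') hρ (by omega) (by omega),
          if_neg (fun h => absurd h.2.1 (by rw [← h23, min_self]; omega)), if_neg (fun h => absurd h.2.2.2.2.1 (by omega)), add_zero]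
  · have hB0 : ¬ (2 ∣ 2 * t' ∧ n₂ = n₃ ∧ n₁ = n₂ + 2 * t' ∧ n₂ < 2 * ρ ∧ 2 * ρ - n₂ ≤ n₂ - d + 1) := fun h => hloc₁ h.2.2.1
    have hB : ¬ (2 ∣ 2 * t' ∧ n₂ = n₃ ∧ n₁ = n₂ + 2 * t' ∧ n₂ < 2 * ρ + ℓ₁ ∧ ℓ₁ + ρ ≤ n₂ ∧ ℓ₁ + 2 * ρ - n₂ ≤ n₂ - d + 1 ∧ 2 * ρ + ℓ₂ ≤ 2 * n₂) :=
      fun h => hloc₁ h.2.2.1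
    rw [if_neg hB, add_zero]
    by_cases hloc₂ : 2 * n₁ = 2 * n₂ + 2 * t'
    · -- `D₂` on its locus (`n₁ = n₂ + t′`): tube or empty
      by_cases htube : 2 * ρ + 2 * t' ≤ n₁ ∧ 2 * ρ ≤ n₂
      · rw [finsum_kappaCount_mul_stabiliserWeight_stratum_G1_sep_levels_tube_locusTwo_of_vac hD h2 hE hN₀ hT ρ t' hρ ht' (by omega) i ℓ₁ ℓ₂
            (by omega) f₀ hσf₀ hglue]
        by_cases hr : ℓ₁ + 2 * ρ + t' ≤ n₂
        · rw [if_pos hr, if_neg hB0, add_zero]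
          exact if_congr ⟨fun h => ⟨h.1, h.2.1, h.2.2, by omega, by omega, by omega⟩, fun h => ⟨h.1, h.2.1, h.2.2.1⟩⟩ rfl rfl
        · rw [if_neg hr, if_neg (fun h => hr (by have := h.2.2.2.2.1; omega))]
      · rw [finsum_stratum_G1_sep_eq_zero_of_offFoot' hD hE hT ρ t' hρ ht' hloc₁ htube,
          if_neg (fun h => htube ⟨h.2.2.1, (le_min_iff.1 h.2.1).1⟩)]
    · -- both tokens off their loci
      rw [finsum_kappaCount_mul_stabiliserWeight_stratum_G1_sep_levels_offLocus hD h2 hE hN₀ hT ρ (2 * t') hρ (by omega) hloc₁ hloc₂ i ℓ₁ ℓ₂ f₀ hσf₀ hglue]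
      by_cases hr : (ℓ₁ + 2 * ρ + 2 * t' ≤ n₁ ∧ ℓ₁ + 2 * ρ ≤ n₂) ∧ (ℓ₂ + 2 * ρ ≤ 2 * n₂ ∧ ℓ₂ + 2 * ρ + 2 * t' ≤ 2 * n₁)
      · rw [if_pos hr, if_neg hB0, add_zero]
        exact if_congr ⟨fun h => ⟨h.1, h.2.1, h.2.2, by omega, by omega, by omega⟩, fun h => ⟨h.1, h.2.1, h.2.2.1⟩⟩ rfl rfl
      · rw [if_neg hr, if_neg (fun h => hr ⟨⟨by omega, by omega⟩, by omega, by omega⟩)]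

/-! ## §3  The G2 cell in box-sum currency, by the swap `(0 1)` -/

open Classical in
/-- **GLUED CELL `G2(ρ,s)` IN BOX-SUM CURRENCY** (same fence; `εG 1 = (ω·ω(f₁)ω(1+f₁), ω·ω(1+f₁), ω(f₁))`, `f₁` the trunk's second glue witness,
`hf₁ : n₁ = n₃ → n₁ ≤ n₂ → |f₁ + (α−1)∕(β−1)| ≤ |ϖ|^{n₂−d+1}`): §2 on the swapped datum through ★ T3 `…_G2_sep_two_of_G1` — `hG2` of `LevLabelledBoxSum` token for token.
[cite: Kottwitz1986BaseChangeUnits, §1 pp. 240–241] [cite: LanglandsShelstad1987, §3] [cite: Rogawski1990, §4.9 Prop. 4.9.1 (a)(b) p. 55] -/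
theorem cell_G2 (hD : IsRamifiedQuadraticDatum σ ϖ d t) (h2 : Valued.v (2 : K) < 1) (hE : IsElementDatum σ ϖ N₀ α β n₁ n₂ n₃) (hN₀ : d ≤ N₀)
    (hT : (T : Matrix (Fin 3) (Fin 3) K) = Matrix.diagonal ![α, β, 1]) (hd2 : 2 ≤ d) (hfence : 2 * d ≤ n₁ + 1 ∧ 2 * d ≤ n₂ + 1 ∧ 2 * d ≤ n₃ + 1)
    {ℓ₁ ℓ₂ : ℕ} (hℓ₁ : ℓ₁ ≤ 2) (hℓ₂ : ℓ₂ ≤ n₁ ∧ ℓ₂ ≤ n₂ ∧ ℓ₂ ≤ n₃) (ρ s : ℕ) (hρ : 1 ≤ ρ) (hs : 1 ≤ s) (i : Fin 3) (f₁ : K) (hσf₁ : σ f₁ = f₁)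
    (hf₁ : n₁ = n₃ → n₁ ≤ n₂ → Valued.v (f₁ + (α - 1) / (β - 1)) ≤ Valued.v ϖ ^ (n₂ - d + 1)) :
    ∑ᶠ M ∈ {M | M ∈ stratum σ ϖ T ![2 * ρ + s, 2 * ρ, 2 * ρ + s] ∧
        (LatticeInLevel ϖ ℓ₁ (Matrix.diagonal ![α - 1, β - 1, 0]) M ∧ LatticeInLevel ϖ ℓ₂ (Matrix.diagonal ![(α - 1) * (α - 1), (β - 1) * (β - 1), 0]) M)},
        (kappaCount σ ϖ 0 i M : ℚ) * stabiliserWeight σ M =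
      (if 2 ∣ s ∧ 2 * ρ ≤ min n₁ n₃ ∧ 2 * ρ + s ≤ n₂ ∧ 2 * ρ + ℓ₁ ≤ n₁ ∧ 2 * ρ + s + ℓ₁ ≤ n₂ ∧ 2 * ρ + ℓ₂ ≤ 2 * n₁ then
          (![0, (normSign σ (-1 : K) : ℚ) * (Fintype.card 𝓀[K] : ℚ) ^ (2 * ρ + s / 2 - 1) *
              ((if 2 * d ≤ s then (Fintype.card 𝓀[K] : ℚ) - 1 else 0) - (if s + 2 = 2 * d then 1 else 0)), 0] : Fin 3 → ℚ) i
        else 0) +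
      (if 2 ∣ s ∧ n₁ = n₃ ∧ n₂ = n₁ + s ∧ n₁ < 2 * ρ + ℓ₁ ∧ ℓ₁ + ρ ≤ n₁ ∧ ℓ₁ + 2 * ρ - n₁ ≤ n₁ - d + 1 ∧ 2 * ρ + ℓ₂ ≤ 2 * n₁ then
          (![if 2 * d ≤ ℓ₁ + 2 * ρ - n₁ + 1 then (normSign σ (-1 : K) : ℚ) * normSign σ f₁ * normSign σ (1 + f₁) else 0,
             if 2 * d ≤ s + (ℓ₁ + 2 * ρ - n₁ + 1) then (normSign σ (-1 : K) : ℚ) * normSign σ (1 + f₁) else 0,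
             if 2 * d ≤ ℓ₁ + 2 * ρ - n₁ + 1 then (normSign σ f₁ : ℚ) else 0] : Fin 3 → ℚ) i *
            (Fintype.card 𝓀[K] : ℚ) ^ (2 * ρ + s / 2 - (ℓ₁ + 2 * ρ - n₁ + 1) / 2)
        else 0) := by
  classical
  -- the G1 statement to be rotated: hypotheses packaged as `Hyp`, value as `F`
  let Hyp : K → K → ℕ → ℕ → ℕ → (Fin 3 → K) → (Fin 3 → K) → Prop := fun α' β' n₁' n₂' n₃' e₁' e₂' =>
    e₁' = ![α' - 1, β' - 1, 0] ∧ e₂' = ![(α' - 1) * (α' - 1), (β' - 1) * (β' - 1), 0] ∧ (2 * d ≤ n₁' + 1 ∧ 2 * d ≤ n₂' + 1 ∧ 2 * d ≤ n₃' + 1) ∧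
      (ℓ₂ ≤ n₁' ∧ ℓ₂ ≤ n₂' ∧ ℓ₂ ≤ n₃') ∧ (n₂' = n₃' → n₂' ≤ n₁' → Valued.v (f₁ + (β' - 1) / (α' - 1)) ≤ Valued.v ϖ ^ (n₁' - d + 1))
  let F : K → K → ℕ → ℕ → ℕ → (Fin 3 → K) → (Fin 3 → K) → Fin 3 → ℚ := fun _ _ n₁' n₂' n₃' _ _ j =>
    (if 2 ∣ s ∧ 2 * ρ ≤ min n₂' n₃' ∧ 2 * ρ + s ≤ n₁' ∧ 2 * ρ + ℓ₁ ≤ n₂' ∧ 2 * ρ + s + ℓ₁ ≤ n₁' ∧ 2 * ρ + ℓ₂ ≤ 2 * n₂' then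
        (![(normSign σ (-1 : K) : ℚ) * (Fintype.card 𝓀[K] : ℚ) ^ (2 * ρ + s / 2 - 1) *
            ((if 2 * d ≤ s then (Fintype.card 𝓀[K] : ℚ) - 1 else 0) - (if s + 2 = 2 * d then 1 else 0)), 0, 0] : Fin 3 → ℚ) j
      else 0) +
    (if 2 ∣ s ∧ n₂' = n₃' ∧ n₁' = n₂' + s ∧ n₂' < 2 * ρ + ℓ₁ ∧ ℓ₁ + ρ ≤ n₂' ∧ ℓ₁ + 2 * ρ - n₂' ≤ n₂' - d + 1 ∧ 2 * ρ + ℓ₂ ≤ 2 * n₂' then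
        (![if 2 * d ≤ s + (ℓ₁ + 2 * ρ - n₂' + 1) then (normSign σ (-1 : K) : ℚ) * normSign σ (1 + f₁) else 0,
           if 2 * d ≤ ℓ₁ + 2 * ρ - n₂' + 1 then (normSign σ (-1 : K) : ℚ) * normSign σ f₁ * normSign σ (1 + f₁) else 0,
           if 2 * d ≤ ℓ₁ + 2 * ρ - n₂' + 1 then (normSign σ f₁ : ℚ) else 0] : Fin 3 → ℚ) j *
          (Fintype.card 𝓀[K] : ℚ) ^ (2 * ρ + s / 2 - (ℓ₁ + 2 * ρ - n₂' + 1) / 2)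
      else 0)
  have hG1 : ∀ {α' β' : K} {n₁' n₂' n₃' : ℕ} (T' : GL (Fin 3) K) (e₁' e₂' : Fin 3 → K), IsElementDatum σ ϖ N₀ α' β' n₁' n₂' n₃' →
      (T' : Matrix (Fin 3) (Fin 3) K) = Matrix.diagonal ![α', β', 1] → Hyp α' β' n₁' n₂' n₃' e₁' e₂' →
        ∀ j : Fin 3, ∑ᶠ M ∈ {M | M ∈ stratum σ ϖ T' ![2 * ρ, 2 * ρ + s, 2 * ρ + s] ∧
            (LatticeInLevel ϖ ℓ₁ (Matrix.diagonal e₁') M ∧ LatticeInLevel ϖ ℓ₂ (Matrix.diagonal e₂') M)},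
          (kappaCount σ ϖ 0 j M : ℚ) * stabiliserWeight σ M = F α' β' n₁' n₂' n₃' e₁' e₂' j := by
    intro α' β' n₁' n₂' n₃' T' e₁' e₂' hE' hT' hHyp j
    obtain ⟨rfl, rfl, hfence', hℓ₂', hf'⟩ := hHyp
    exact cell_G1 hD h2 hE' hN₀ hT' hd2 hfence' hℓ₁ hℓ₂' ρ s hρ hs j f₁ hσf₁ hf'
  have hHyp : Hyp β α n₂ n₁ n₃ ![(![α - 1, β - 1, 0] : Fin 3 → K) 1, (![α - 1, β - 1, 0] : Fin 3 → K) 0, (![α - 1, β - 1, 0] : Fin 3 → K) 2]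
      ![(![(α - 1) * (α - 1), (β - 1) * (β - 1), 0] : Fin 3 → K) 1, (![(α - 1) * (α - 1), (β - 1) * (β - 1), 0] : Fin 3 → K) 0,
        (![(α - 1) * (α - 1), (β - 1) * (β - 1), 0] : Fin 3 → K) 2] :=
    ⟨rfl, rfl, ⟨hfence.2.1, hfence.1, hfence.2.2⟩, ⟨hℓ₂.2.1, hℓ₂.1, hℓ₂.2.2⟩, hf₁⟩
  rw [finsum_kappaCount_mul_stabiliserWeight_stratum_G2_sep_two_of_G1 hE hT ρ s ℓ₁ ℓ₂ Hyp F hG1 _ _ hHyp i]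
  fin_cases i <;> simp [F, Equiv.swap_apply_of_ne_of_ne, Equiv.swap_apply_left, Equiv.swap_apply_right]

end Summit.HodgeConjecture.HodgeConjecture.Cruxes.H413.F0P3cDyRamLevLabelledCellsGlued

end
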